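import Literature.Computability.Complexity.CoinBlocksOr
import Literature.Computability.Complexity.PromiseZPPProofs
import HarnessLib

/-!
# One-sided error with a `1/poly` gap is already promise-`RP` / promise-`coRP`

Toolkit file (theorems only), continuation of `CoinBlocksOr.lean` (the block disjunction
`CoinBlocks.blockOr A ℓ K ∈ P`, "some block of the coin string is accepted", and the counting of
coin strings all of whose blocks fail) and of `PromiseZPP.lean` / `PromiseZPPProofs.lean` (the
textbook one-sided promise classes `PromiseRP'`, `PromiseCoRP'`, which ask for success probability
`≥ 1/2` on the promise). It proves the textbook remark that the constant `1/2` is immaterial: a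
witness language accepting NO coin string on no-instances and at least a `1/(r(|x|)+1)` fraction of
them on yes-instances (resp. every coin string on yes-instances and rejecting at least a
`1/(r(|x|)+1)` fraction on no-instances), `r` a polynomial, already puts the promise problem in
`PromiseRP'` (resp. `PromiseCoRP'`): run it on `r(|x|) + 1` independent blocks of coins and accept iff
some block accepts (Arora–Barak 2009, §7.4.1 "error reduction": for `RP` "the constant … can be
replaced by `1/n^c`"; Goldreich 2006, §6.2; Gill 1977, Prop. 5.2). Contents:

* `CoinBlocks.cnt_allBlocks_eq_pow` — the product rule `cnt (Kℓ) {all K blocks in B} = (cnt ℓ B)^K`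
  (the general-`B` form of `CoinBlocks.two_pow_mul_cnt_allBlocks_le`, same three-line induction on
  `cnt_take_drop`);
* `one_sub_inv_pow_le_half` — `(1 - 1/n)^n ≤ 1/2` for `n ≥ 1` (Bernoulli: `(1 + 1/n)^n ≥ 2` and
  `(1 - 1/n)(1 + 1/n) ≤ 1`);
* `CoinBlocks.uniformProb_blockOr_ge_half` — if one block accepts with probability `≥ 1/(r(|x|)+1)`
  then some of `r(|x|) + 1` blocks accepts with probability `≥ 1/2`;
* `mem_PromiseRP'_of_weak`, `mem_PromiseCoRP'_of_weak`, and the corollaries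
  `mem_PromiseBPP'_of_weak_coRP`, `mem_PromiseP_of_weak_coRP` (the last one under the
  derandomisation hypothesis `PromiseBPP' ⊆ PromiseP`, the form in which Hirahara 2021 uses
  "`Π ∈ pr-coRP`; using Lemma 3.4, `Π ∈ pr-BPP = pr-P`", ECCC TR21-058, p. 29).

No new definitions. Written for the inline proof plan of
`Literature.Computability.MetaComplexity.Hirahara2021_languageCompression` (Lemma 3.6 substitute
and the final `pr-coRP` step of Thm. 4.2), but independent of it.

## References

* S. Arora, B. Barak, *Computational Complexity: A Modern Approach*, CUP 2009, §7.4.1 (error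
  reduction for `RP` by independent repetitions; the success constant is immaterial)
  [AroraBarakCC2009].
* O. Goldreich, *On promise problems: a survey*, LNCS 3895 (2006), §6.2 (promise-`RP`,
  promise-`coRP`) [GoldreichPromise2006].
* J. Gill, *Computational complexity of probabilistic Turing machines*, SIAM J. Comput. 6 (1977),
  Prop. 5.2 [Gill1977].
* S. Hirahara, ECCC TR21-058 (2021), p. 29 (the `pr-coRP ⊆ pr-BPP = pr-P` step) [Hirahara2021].
-/

noncomputable section

namespace Literature.Computability.Complexity

open _root_.Computability Polynomial
open HashBricks (blk)

/-! ### Counting: all blocks fail -/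

namespace CoinBlocks

/-- **Product rule for `K` independent blocks**: the strings of length `Kℓ` all of whose `K`
blocks of length `ℓ` lie in `B` number exactly `(cnt ℓ B)^K` (induction on `K` with the product
rule `cnt_take_drop`; the general-`B` form of `two_pow_mul_cnt_allBlocks_le`).
[cite: AroraBarakCC2009, §7.4.1 (independent repetitions)] -/
theorem cnt_allBlocks_eq_pow (ℓ : ℕ) (B : Set (List Bool)) :
    ∀ K : ℕ, cnt (K * ℓ) (allBlocks ℓ K B) = cnt ℓ B ^ K
  | 0 => by
    rw [Nat.zero_mul, pow_zero, cnt_eq_two_pow_of_forall (fun y _ => ?_), pow_zero]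
    intro j hj
    exact absurd hj (Nat.not_lt_zero j)
  | K + 1 => by
    have ih := cnt_allBlocks_eq_pow ℓ B K
    have hlen : (K + 1) * ℓ = ℓ + K * ℓ := by ring
    have hprod : cnt ((K + 1) * ℓ) (allBlocks ℓ (K + 1) B) = cnt ℓ B * cnt (K * ℓ) (allBlocks ℓ K B) := by
      rw [hlen, ← cnt_take_drop ℓ (K * ℓ) B (allBlocks ℓ K B)]
      exact cnt_congr fun y _ => mem_allBlocks_succ ℓ K B y
    rw [hprod, ih, pow_succ, mul_comm]

end CoinBlocks

/-- **`(1 - 1/n)^n ≤ 1/2` for `n ≥ 1`** (elementary: by Bernoulli's inequality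
`(1 + 1/n)^n ≥ 1 + n·(1/n) = 2`, while `(1 - 1/n)^n (1 + 1/n)^n = (1 - 1/n²)^n ≤ 1`).
[folklore] -/
theorem one_sub_inv_pow_le_half {n : ℕ} (hn : 1 ≤ n) : (1 - 1 / (n : ℝ)) ^ n ≤ 1 / 2 := by
  have hn' : (0 : ℝ) < n := by exact_mod_cast hn
  have hle : 1 / (n : ℝ) ≤ 1 := by
    rw [div_le_one hn']
    exact_mod_cast hn
  have hge : (0 : ℝ) ≤ 1 / n := by positivity
  have hx0 : (0 : ℝ) ≤ 1 - 1 / n := by linarith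
  have hbern : (2 : ℝ) ≤ (1 + 1 / (n : ℝ)) ^ n := by
    have h := one_add_mul_le_pow (show (-2 : ℝ) ≤ 1 / n by linarith) n
    have hn1 : (n : ℝ) * (1 / n) = 1 := by field_simp
    linarith
  have hprod : (1 - 1 / (n : ℝ)) ^ n * (1 + 1 / (n : ℝ)) ^ n ≤ 1 := by
    rw [← mul_pow]
    have h1 : (1 - 1 / (n : ℝ)) * (1 + 1 / n) = 1 - (1 / n) ^ 2 := by ring
    rw [h1]
    exact pow_le_one₀ (by nlinarith) (by nlinarith)
  nlinarith [pow_nonneg hx0 n]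

/-! ### The block disjunction boosts a `1/(r+1)` acceptance probability to `1/2` -/

namespace CoinBlocks

variable {A : Language Bool} {p r : Polynomial ℕ} {x : List Bool}

/-- The coin strings on which the block disjunction REJECTS are exactly those all of whose
`r(|x|)+1` blocks are rejected by `A`. [cite: AroraBarakCC2009, §7.4.1] -/
theorem compl_setOf_mem_blockOr (A : Language Bool) (p r : Polynomial ℕ) (x : List Bool) :
    {y : List Bool | boolPair x y ∈ blockOr A p (r + 1)}ᶜ =
      allBlocks (p.eval x.length) (r.eval x.length + 1) {z | boolPair x z ∉ A} := by
  ext y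
  simp only [Set.mem_compl_iff, Set.mem_setOf_eq, boolPair_mem_blockOr, eval_add, eval_one, not_exists,
    not_and, allBlocks]

/-- **Weak gap, boosted**: if `A` accepts `⟨x, z⟩` for at least a `1/(r(|x|)+1)` fraction of the
blocks `z ∈ {0,1}^{p(|x|)}`, then the block disjunction over `r(|x|) + 1` blocks accepts `⟨x, y⟩`
for at least half of the coin strings `y ∈ {0,1}^{(r(|x|)+1)·p(|x|)}`
(`1 - (1 - 1/(r+1))^{r+1} ≥ 1/2`). [cite: AroraBarakCC2009, §7.4.1 (error reduction for RP)] -/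
theorem uniformProb_blockOr_ge_half
    (h : 1 / (((r.eval x.length : ℕ) : ℝ) + 1) ≤ uniformProb (p.eval x.length) {z | boolPair x z ∈ A}) :
    1 / 2 ≤ uniformProb ((r.eval x.length + 1) * p.eval x.length)
      {y | boolPair x y ∈ blockOr A p (r + 1)} := by
  set ℓ := p.eval x.length with hℓ
  set K := r.eval x.length + 1 with hK
  set G : Set (List Bool) := {z | boolPair x z ∈ A} with hG
  set E : Set (List Bool) := {y | boolPair x y ∈ blockOr A p (r + 1)} with hE
  have hK1 : 1 ≤ K := Nat.le_add_left 1 _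
  have hKr : (K : ℝ) = ((r.eval x.length : ℕ) : ℝ) + 1 := by simp [hK]
  -- the rejecting coin strings are those with all blocks bad
  have hcompl : Eᶜ = allBlocks ℓ K Gᶜ := by
    rw [hE, compl_setOf_mem_blockOr]
    rfl
  have hcnt : cnt (K * ℓ) Eᶜ = cnt ℓ Gᶜ ^ K := by
    rw [hcompl, cnt_allBlocks_eq_pow]
  -- probability that all blocks are bad
  have hbad : uniformProb (K * ℓ) Eᶜ = (uniformProb ℓ Gᶜ) ^ K := by
    rw [uniformProb_eq_cnt_div, uniformProb_eq_cnt_div, hcnt, div_pow, ← pow_mul, mul_comm ℓ K]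
    push_cast
    rfl
  have hGc : uniformProb ℓ Gᶜ = 1 - uniformProb ℓ G := uniformProb_compl ℓ G
  have hG1 : uniformProb ℓ G ≤ 1 := uniformProb_le_one ℓ G
  have hKinv : 1 / (K : ℝ) ≤ uniformProb ℓ G := by rw [hKr]; exact h
  have hpow : (uniformProb ℓ Gᶜ) ^ K ≤ 1 / 2 := by
    rw [hGc]
    calc (1 - uniformProb ℓ G) ^ K ≤ (1 - 1 / (K : ℝ)) ^ K :=
          pow_le_pow_left₀ (by linarith) (by linarith) K
      _ ≤ 1 / 2 := one_sub_inv_pow_le_half hK1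
  have hEc : uniformProb (K * ℓ) E = 1 - uniformProb (K * ℓ) Eᶜ := by
    rw [uniformProb_compl]; ring
  rw [hEc, hbad]
  linarith

/-- On the `no` side nothing is lost: if `A` accepts no block `⟨x, z⟩`, `z ∈ {0,1}^{p(|x|)}`, then the
block disjunction accepts no coin string of length `(r(|x|)+1)·p(|x|)` (every block inside the
string has full length, `length_blk`). [cite: AroraBarakCC2009, §7.4.1] -/
theorem boolPair_not_mem_blockOr (h : ∀ z : List Bool, z.length = p.eval x.length → boolPair x z ∉ A)
    {y : List Bool} (hy : y.length = (r.eval x.length + 1) * p.eval x.length) :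
    boolPair x y ∉ blockOr A p (r + 1) := by
  rw [boolPair_mem_blockOr]
  rintro ⟨j, hj, hjA⟩
  rw [eval_add, eval_one] at hj
  refine h _ (length_blk ?_) hjA
  rw [hy]
  exact Nat.mul_le_mul_right _ hj

end CoinBlocks

/-! ### Weak-gap forms of promise-`RP` and promise-`coRP` -/

/-- **One-sided error with a `1/poly` gap is promise-`RP`** (Arora–Barak 2009, §7.4.1; Goldreich
2006, §6.2): if some `L' ∈ P` and polynomials `p, r` satisfy — on every yes-instance `x` at least a
`1/(r(|x|)+1)` fraction of the coin strings `y ∈ {0,1}^{p(|x|)}` have `⟨x, y⟩ ∈ L'`, and on every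
no-instance none does — then `Q ∈ PromiseRP'` (witness: the block disjunction of `L'` over
`r(|x|) + 1` blocks, `CoinBlocks.blockOr_mem_P`, with coin polynomial `(r + 1)·p`).
[cite: AroraBarakCC2009, §7.4.1 (error reduction; the constant is immaterial)] -/
theorem mem_PromiseRP'_of_weak {Q : PromiseProblem} {L' : Language Bool} (hL' : L' ∈ Classes.P)
    (p r : Polynomial ℕ)
    (hyes : ∀ x ∈ Q.yes,
      1 / (((r.eval x.length : ℕ) : ℝ) + 1) ≤ uniformProb (p.eval x.length) {y : List Bool | boolPair x y ∈ L'})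
    (hno : ∀ x ∈ Q.no, ∀ y : List Bool, y.length = p.eval x.length → boolPair x y ∉ L') :
    Q ∈ PromiseRP' := by
  refine ⟨CoinBlocks.blockOr L' p (r + 1), CoinBlocks.blockOr_mem_P hL' p (r + 1), (r + 1) * p,
    fun x hx => ?_, fun x hx y hy => ?_⟩
  · have h := CoinBlocks.uniformProb_blockOr_ge_half (hyes x hx)
    rwa [eval_mul, eval_add, eval_one]
  · rw [eval_mul, eval_add, eval_one] at hy
    exact CoinBlocks.boolPair_not_mem_blockOr (hno x hx) hy

/-- **One-sided error with a `1/poly` gap is promise-`coRP`** (the dual form, Goldreich 2006,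
§6.2, with an always-accepting machine on the yes side): if some `L'' ∈ P` and polynomials `p, r`
satisfy — on every yes-instance `x` EVERY coin string `y ∈ {0,1}^{p(|x|)}` has `⟨x, y⟩ ∈ L''`, and on
every no-instance at least a `1/(r(|x|)+1)` fraction has `⟨x, y⟩ ∉ L''` — then `Q ∈ PromiseCoRP'`
(apply `mem_PromiseRP'_of_weak` to `Q.swap` and the complement `L''ᶜ ∈ P`).
[cite: GoldreichPromise2006, §6.2 (promise-coRP)] -/
theorem mem_PromiseCoRP'_of_weak {Q : PromiseProblem} {L'' : Language Bool} (hL'' : L'' ∈ Classes.P)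
    (p r : Polynomial ℕ)
    (hyes : ∀ x ∈ Q.yes, ∀ y : List Bool, y.length = p.eval x.length → boolPair x y ∈ L'')
    (hno : ∀ x ∈ Q.no,
      1 / (((r.eval x.length : ℕ) : ℝ) + 1) ≤ uniformProb (p.eval x.length) {y : List Bool | boolPair x y ∉ L''}) :
    Q ∈ PromiseCoRP' := by
  rw [mem_PromiseCoRP'_iff]
  refine mem_PromiseRP'_of_weak (L' := L''ᶜ) (compl_mem_P_iff.2 hL'') p r (fun x hx => ?_) (fun x hx y hy => ?_)
  · exact hno x hx
  · exact fun h => h (hyes x hx y hy)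

/-- The same weak `coRP` gap puts `Q` in the textbook promise-`BPP` (`PromiseCoRP' ⊆ PromiseBPP'`).
[cite: GoldreichPromise2006, §6.2] -/
theorem mem_PromiseBPP'_of_weak_coRP {Q : PromiseProblem} {L'' : Language Bool} (hL'' : L'' ∈ Classes.P)
    (p r : Polynomial ℕ)
    (hyes : ∀ x ∈ Q.yes, ∀ y : List Bool, y.length = p.eval x.length → boolPair x y ∈ L'')
    (hno : ∀ x ∈ Q.no,
      1 / (((r.eval x.length : ℕ) : ℝ) + 1) ≤ uniformProb (p.eval x.length) {y : List Bool | boolPair x y ∉ L''}) :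
    Q ∈ PromiseBPP' :=
  PromiseCoRP'_subset_PromiseBPP' (mem_PromiseCoRP'_of_weak hL'' p r hyes hno)

/-- **Under `pr-BPP = pr-P` a weak one-sided gap is decided in `P`**: the form in which Hirahara
uses it ("It follows from Claim 4.7 that `Π ∈ pr-coRP`. Using Lemma 3.4, we conclude that
`Π ∈ pr-BPP = pr-P`", ECCC TR21-058, p. 29) — given the inclusion `PromiseBPP' ⊆ PromiseP`, a
witness `L'' ∈ P` accepting every coin string on yes-instances and rejecting at least a
`1/(r(|x|)+1)` fraction on no-instances yields `Q ∈ PromiseP`.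
[cite: Hirahara2021, Thm. 4.2 (proof, p. 29: pr-coRP ⊆ pr-BPP = pr-P)] -/
theorem mem_PromiseP_of_weak_coRP (hD : PromiseBPP' ⊆ PromiseP) {Q : PromiseProblem} {L'' : Language Bool}
    (hL'' : L'' ∈ Classes.P) (p r : Polynomial ℕ)
    (hyes : ∀ x ∈ Q.yes, ∀ y : List Bool, y.length = p.eval x.length → boolPair x y ∈ L'')
    (hno : ∀ x ∈ Q.no,
      1 / (((r.eval x.length : ℕ) : ℝ) + 1) ≤ uniformProb (p.eval x.length) {y : List Bool | boolPair x y ∉ L''}) :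
    Q ∈ PromiseP :=
  hD (mem_PromiseBPP'_of_weak_coRP hL'' p r hyes hno)

end Literature.Computability.Complexity
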